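import Mathlib
import Literature.Analysis.Convex.SchauderFixedPoint
import Summits.NavierStokesRegularity.NavierStokesRegularity.Theorems.WakeRatchetTailRatchetSharpWake
import HarnessLib

/-!
# `WakeRatchet.TailRatchet` (stmt-NavierStokesRegularity-21808): fixed points on window states and
# invariant sets that are convex only in CONJUGATE coordinates (constant-flux tubes)

Support file for the crux `TailRatchet` (route `WakeRatchet`; MODEL lattice ODEs of Tao 2016 §4 —
nothing here is a statement about the Navier–Stokes equations).  Eighth helper of the reduction of the
blocking construction `DyadicScalarFronts` to a finite-dimensional fixed-point problem.  Why it is needed: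
for small `ε₀` the near wake of the dyadic front (`≍ ε₀⁻¹ log ε₀⁻¹` shells behind the leading edge) is a
CONSTANT-FLUX state — each of the two terms of `ż_m = Λ^{m-1}z_{m-1}² − Λ^m z_m z_{m+1}` is `≍ Π/z_m`, large,
and only their difference is small — so a product box is not invariant there (the crude drift per period,
summed over the wake, is `O(1/ε₀)`); the natural invariant set is a flux tube
`Λ^m x_m² x_{m+1} ∈ [Π⁻, Π⁺]`, which is convex in LOGARITHMIC amplitudes but not in the amplitudes.  Schauder
only needs convexity up to homeomorphism:

* `exists_fixedPoint_window` — Schauder for a continuous self-map of a nonempty compact convex set of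
  lattice states vanishing off the window `|n| ≤ K` (transport to `Icc (-K) K → ℝ` and the tree's
  `Literature.Analysis.Convex.exists_fixedPoint_of_mapsTo_isCompact`); the generic core of
  `truncatedPeriod_of_invariant`;
* `exists_fixedPoint_conj` — the same for an invariant set `e '' C'`, `C'` compact convex, `e` continuous
  with a continuous left inverse `e'` on the image (fixed point of the conjugate `e' ∘ F ∘ e`);
* `truncatedPeriod_of_invariant_conj` — the relative periodic point of the `K`-truncated dyadic lattice
  (the hypothesis of `latticePeriod_of_truncations`) from a one-period-map-invariant set of that kind —
  drop-in replacement for `truncatedPeriod_of_invariant` inside `dyadicScalarFronts_of_invariantSets_weak`'s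
  proof pattern when the wake part of the set is a flux tube.

HONEST FRAMING: fixed-point packaging about a finite-dimensional MODEL ODE; no registered stub is closed,
no summit statement is touched.
-/

noncomputable section

set_option linter.dupNamespace false

namespace Summit.NavierStokesRegularity.NavierStokesRegularity.Theorems

namespace WakeRatchetLatticePeriod

open Set Filter Topology MeasureTheory
open Literature.Analysis.FluidPDE Literature.Analysis.FluidPDE.TaoCascade
open WakeRatchetDyadicFront

/-- **Schauder on window states.**  A nonempty compact convex set `C` of lattice states (product topology
on `ℤ → ℝ`) all vanishing off the window `|n| ≤ K`, and a map `F` continuous on `C` with `F(C) ⊆ C`, have a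
fixed point (transport to the finite-dimensional window space `Icc (-K) K → ℝ`, the tree's Schauder theorem
`Literature.Analysis.Convex.exists_fixedPoint_of_mapsTo_isCompact`, transport back). [folklore] -/
theorem exists_fixedPoint_window {K : ℕ} (C : Set (ℤ → ℝ)) (F : (ℤ → ℝ) → (ℤ → ℝ))
    (hCconv : Convex ℝ C) (hCcomp : IsCompact C) (hCne : C.Nonempty)
    (hCK : ∀ x ∈ C, ∀ n : ℤ, (K : ℤ) < |n| → x n = 0)
    (hFc : ContinuousOn F C) (hF : MapsTo F C C) :
    ∃ x ∈ C, F x = x := by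
  set r : (ℤ → ℝ) → (↥(Set.Icc (-(K : ℤ)) (K : ℤ)) → ℝ) := fun x k => x k with hr
  set e : (↥(Set.Icc (-(K : ℤ)) (K : ℤ)) → ℝ) → (ℤ → ℝ) :=
    fun ξ n => if h : |n| ≤ (K : ℤ) then ξ ⟨n, abs_le.1 h⟩ else 0 with he
  have hrc : Continuous r := continuous_pi fun k => continuous_apply (k : ℤ)
  have hec : Continuous e := by
    refine continuous_pi fun n => ?_
    by_cases h : |n| ≤ (K : ℤ)
    · simp only [he, dif_pos h]; exact continuous_apply _
    · simp only [he, dif_neg h]; exact continuous_const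
  have her : ∀ x ∈ C, e (r x) = x := by
    intro x hx; funext n
    by_cases h : |n| ≤ (K : ℤ)
    · simp only [he, hr, dif_pos h]
    · simp only [he, dif_neg h]; exact (hCK x hx n (not_le.1 h)).symm
  set rL : (ℤ → ℝ) →ₗ[ℝ] (↥(Set.Icc (-(K : ℤ)) (K : ℤ)) → ℝ) :=
    { toFun := r, map_add' := fun x y => rfl, map_smul' := fun c x => rfl } with hrL
  set CE : Set (↥(Set.Icc (-(K : ℤ)) (K : ℤ)) → ℝ) := r '' C with hCE
  have hCEconv : Convex ℝ CE := by
    have : CE = rL '' C := rfl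
    rw [this]; exact hCconv.linear_image rL
  have hCEcomp : IsCompact CE := hCcomp.image hrc
  have hCEne : CE.Nonempty := hCne.image r
  have heC : MapsTo e CE C := by
    rintro _ ⟨x, hx, rfl⟩; rw [her x hx]; exact hx
  set G : (↥(Set.Icc (-(K : ℤ)) (K : ℤ)) → ℝ) → (↥(Set.Icc (-(K : ℤ)) (K : ℤ)) → ℝ) :=
    fun ξ => r (F (e ξ)) with hG
  have hGc : ContinuousOn G CE := hrc.comp_continuousOn (hFc.comp hec.continuousOn heC)
  have hGmaps : MapsTo G CE CE := by
    rintro _ ⟨x, hx, rfl⟩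
    exact ⟨F x, hF hx, by simp only [hG, her x hx]⟩
  obtain ⟨ξ, hξ, hfix⟩ := Literature.Analysis.Convex.exists_fixedPoint_of_mapsTo_isCompact hCEconv
    hCEcomp.isClosed hCEne hCEcomp hGc hGmaps hGmaps
  obtain ⟨x, hx, rfl⟩ := hξ
  refine ⟨x, hx, ?_⟩
  have h1 : r (F x) = r x := by
    have := hfix; simp only [hG, her x hx] at this; exact this
  funext n
  by_cases h : |n| ≤ (K : ℤ)
  · have := congr_fun h1 ⟨n, abs_le.1 h⟩
    simpa only [hr] using this
  · rw [hCK x hx n (not_le.1 h), hCK (F x) (hF hx) n (not_le.1 h)]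

/-- **Fixed points on sets that are convex only in other coordinates** (e.g. logarithmic amplitudes on
the wake, where a constant-flux tube `Λ^m x_m² x_{m+1} ∈ [Π⁻, Π⁺]` is convex).  If `C = e '' C'` for a
nonempty compact convex set `C'` of window states, `e` continuous on `C'` with values vanishing off the
window, `e'` continuous on `C` and a left inverse of `e` on `C'`, and `F` is continuous on `C` with
`F(C) ⊆ C`, then `F` has a fixed point in `C` (Schauder for the conjugate `e' ∘ F ∘ e` on `C'`). [folklore] -/
theorem exists_fixedPoint_conj {K : ℕ} (C' : Set (ℤ → ℝ)) (e e' F : (ℤ → ℝ) → (ℤ → ℝ))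
    (hCconv : Convex ℝ C') (hCcomp : IsCompact C') (hCne : C'.Nonempty)
    (hCK : ∀ y ∈ C', ∀ n : ℤ, (K : ℤ) < |n| → y n = 0)
    (hec : ContinuousOn e C') (he'c : ContinuousOn e' (e '' C'))
    (hinv : ∀ y ∈ C', e' (e y) = y)
    (hFc : ContinuousOn F (e '' C')) (hF : MapsTo F (e '' C') (e '' C')) :
    ∃ x ∈ e '' C', F x = x := by
  have heM : MapsTo e C' (e '' C') := mapsTo_image e C'
  have hG : MapsTo (fun y => e' (F (e y))) C' C' := by
    intro y hy
    obtain ⟨y', hy', hy'e⟩ := hF (heM hy)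
    show e' (F (e y)) ∈ C'
    rw [← hy'e, hinv y' hy']; exact hy'
  have hGc : ContinuousOn (fun y => e' (F (e y))) C' :=
    he'c.comp (hFc.comp hec heM) (hF.comp heM)
  obtain ⟨y, hy, hfix⟩ := exists_fixedPoint_window C' (fun y => e' (F (e y))) hCconv hCcomp hCne hCK hGc hG
  refine ⟨e y, heM hy, ?_⟩
  obtain ⟨y', hy', hy'e⟩ := hF (heM hy)
  -- `F (e y) = e y'` with `y' ∈ C'`; the fixed-point equation identifies `y' = y`
  have : y' = y := by rw [← hinv y' hy', hy'e]; exact hfix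
  rw [← hy'e, this]

/-- **Relative periodic point of the truncated dyadic lattice from an invariant set that is convex in
conjugate coordinates** (generalises `truncatedPeriod_of_invariant`): the invariant set may be `e '' C'`
for a compact convex `C'` and a coordinate change `e` with continuous left inverse — in particular a
constant-flux tube in the wake (convex in logarithmic amplitudes) times a box at the front.
[folklore] -/
theorem truncatedPeriod_of_invariant_conj {L : ℝ} {K : ℕ} {Tmin Tmax lo : ℝ} (b : ℤ → ℝ)
    (C' : Set (ℤ → ℝ)) (e e' : (ℤ → ℝ) → (ℤ → ℝ)) (Tf : (ℤ → ℝ) → ℝ) (Φ : (ℤ → ℝ) → ℝ → (ℤ → ℝ))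
    (hL : 0 < L) (hTmin : 0 < Tmin)
    (hCconv : Convex ℝ C') (hCcomp : IsCompact C') (hCne : C'.Nonempty)
    (hCK' : ∀ y ∈ C', ∀ n : ℤ, (K : ℤ) < |n| → y n = 0)
    (hec : ContinuousOn e C') (he'c : ContinuousOn e' (e '' C')) (hinv : ∀ y ∈ C', e' (e y) = y)
    (hClo : ∀ x ∈ e '' C', lo ≤ x 0)
    (hΦ : ∀ x ∈ e '' C', (∀ n : ℤ, Φ x 0 n = x n) ∧
      (∀ n : ℤ, (K : ℤ) < |n| → ∀ t ∈ Icc (0 : ℝ) Tmax, Φ x t n = 0) ∧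
      (∀ n : ℤ, |n| ≤ (K : ℤ) → ∀ t ∈ Icc (0 : ℝ) Tmax, HasDerivWithinAt (fun s => Φ x s n)
        (L ^ (n - 1) * Φ x t (n - 1) ^ 2 - L ^ n * Φ x t n * Φ x t (n + 1)) (Icc (0 : ℝ) Tmax) t))
    (hΦc : ∀ n : ℤ, ContinuousOn (fun p : (ℤ → ℝ) × ℝ => Φ p.1 p.2 n) ((e '' C') ×ˢ Icc (0 : ℝ) Tmax))
    (hb : ∀ x ∈ e '' C', ∀ n : ℤ, ∀ t ∈ Icc (0 : ℝ) Tmax, |Φ x t n| ≤ b n)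
    (hTc : ContinuousOn Tf (e '' C')) (hTI : ∀ x ∈ e '' C', Tf x ∈ Icc Tmin Tmax)
    (hinvset : ∀ x ∈ e '' C', (fun n : ℤ => if -(K : ℤ) ≤ n ∧ n ≤ (K : ℤ) - 1 then
        ((1 + Tf x) / L)⁻¹ * Φ x (Tf x) (n + 1) else 0) ∈ e '' C') :
    ∃ (T : ℝ) (Z : ℤ → ℝ → ℝ), T ∈ Icc Tmin Tmax ∧
      (∀ n : ℤ, |n| ≤ (K : ℤ) → ∀ t ∈ Icc (0 : ℝ) Tmax, HasDerivWithinAt (Z n)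
        (L ^ (n - 1) * Z (n - 1) t ^ 2 - L ^ n * Z n t * Z (n + 1) t) (Icc (0 : ℝ) Tmax) t) ∧
      (∀ n : ℤ, (K : ℤ) < |n| → ∀ t ∈ Icc (0 : ℝ) Tmax, Z n t = 0) ∧
      (∀ n : ℤ, ∀ t ∈ Icc (0 : ℝ) Tmax, |Z n t| ≤ b n) ∧
      (∀ n : ℤ, |n| < (K : ℤ) → Z n T = (1 + T) / L * Z (n - 1) 0) ∧
      lo ≤ Z 0 0 := by
  set C : Set (ℤ → ℝ) := e '' C' with hCdef
  set Ψ : (ℤ → ℝ) → (ℤ → ℝ) := fun x n => if -(K : ℤ) ≤ n ∧ n ≤ (K : ℤ) - 1 then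
      ((1 + Tf x) / L)⁻¹ * Φ x (Tf x) (n + 1) else 0 with hΨ
  -- continuity of the one-period map on `C`
  have hΨc : ContinuousOn Ψ C := by
    refine continuousOn_pi.2 fun n => ?_
    by_cases hn : -(K : ℤ) ≤ n ∧ n ≤ (K : ℤ) - 1
    · have h1 : ContinuousOn (fun x => Φ x (Tf x) (n + 1)) C := by
        have hmt : MapsTo (fun x : ℤ → ℝ => (x, Tf x)) C (C ×ˢ Icc (0 : ℝ) Tmax) :=
          fun x hx => ⟨hx, ⟨hTmin.le.trans (hTI x hx).1, (hTI x hx).2⟩⟩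
        exact (hΦc (n + 1)).comp (continuousOn_id.prodMk hTc) hmt
      have h3 : ContinuousOn (fun x => (1 + Tf x) / L) C :=
        ContinuousOn.div_const (ContinuousOn.add continuousOn_const hTc) L
      have h2 : ContinuousOn (fun x => ((1 + Tf x) / L)⁻¹) C :=
        h3.inv₀ fun x hx => (div_pos (by linarith [(hTI x hx).1]) hL).ne'
      refine (h2.mul h1).congr fun x _ => ?_
      simp only [hΨ, if_pos hn, Pi.mul_apply]
    · refine (continuousOn_const (c := (0 : ℝ))).congr fun x _ => ?_
      simp only [hΨ, if_neg hn]
  obtain ⟨x, hxC, hΨx⟩ := exists_fixedPoint_conj C' e e' Ψ hCconv hCcomp hCne hCK' hec he'c hinv hΨc hinvset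
  obtain ⟨h0, hz, hd⟩ := hΦ x hxC
  refine ⟨Tf x, fun n t => Φ x t n, hTI x hxC, fun n hn t ht => hd n hn t ht, hz,
    fun n t ht => hb x hxC n t ht, fun n hn => ?_, ?_⟩
  · have hn' : -(K : ℤ) ≤ n - 1 ∧ n - 1 ≤ (K : ℤ) - 1 := by rw [abs_lt] at hn; omega
    have := congr_fun hΨx (n - 1)
    simp only [hΨ, if_pos hn', sub_add_cancel] at this
    show Φ x (Tf x) n = (1 + Tf x) / L * Φ x 0 (n - 1)
    have hs0 : (1 + Tf x) ≠ 0 := (by linarith [(hTI x hxC).1] : (0 : ℝ) < 1 + Tf x).ne'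
    rw [h0 (n - 1), ← this]
    field_simp
  · show lo ≤ Φ x 0 0
    rw [h0 0]; exact hClo x hxC

end WakeRatchetLatticePeriod

end Summit.NavierStokesRegularity.NavierStokesRegularity.Theorems

end
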